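import Summits.Ventures.PercRepro.S2ThirteenEightNuFive
import Summits.Ventures.PercRepro.S2TailCell
import Summits.Ventures.PercRepro.S2DichotomyTools

/-!
# PercRepro — S2: THE CASE `ν = 7` OF THE COLOOP-FREE CELL `(13, 8)`, AND THE CELL MODULO `ν = 4` AND ITS SPREAD CASE (p7, gen 17)

The case `ν = 7 = d − 1` (a set of nullity `7` on `≤ 12` points) by the kit's hitting counts against the kit's tail at `(13, 8)`
(its rank part is exactly `369971652551 / 2072700`): `#U ≤ 30030`, `#spanning ≤ 33515`, `m = 104`, ratio `0.44` —
**`c025_thirteen_eight_cf_nu_seven`**; with the cases `ν = 6, 5` of S2ThirteenEightNuSix / NuFive, the coloop-free cell `(13, 8)` modulo its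
case `ν = 4` and its spread case: **`c025_thirteen_eight_cf_of_nu_four_of_spread`** (both hypotheses OPEN: the kit prices them `1.23` and
`1.21`; the lane README says what they need). Nothing about the cell is claimed. Axioms: standard.
-/

open scoped Matroid

namespace PercRepro

namespace ThmN

open Set

variable {α : Type}

/-- The tail side of the cell `(13, 8)` on the caps `13 / 85 / 526` with the spanning count `S` a parameter: the rank-`≤ 5` part
of the kit's tail is exactly `369971652551 / 2072700`. -/
theorem tail_thirteen_eight_cf (S m : ℕ) (h : (1024 : ℚ) * ((369971652551 / 2072700 : ℚ) + (S : ℚ)) ≤ (m : ℚ) * 2 ^ 21) :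
    1024 * ((((13 + 8).choose 4 : ℚ) +
      (∑ j ∈ Finset.range 6, (Nat.choose (min 5 ((8 + 3) / 2 + 1 - 2)) j : ℚ) / (((j + 1) + 3 * (j + 1).choose 2 + 3 * (j + 1).choose 3 + 2 * (j + 1).choose 4 : ℕ) : ℚ)) *
        ((13 * (13 + 8 - 3).choose 2 + 85 * (13 + 8 - 4) + 526 : ℕ) : ℚ) +
      ((∑ j ∈ Finset.range 6, (Nat.choose 5 j : ℚ) / (((j + 1) + 3 * (j + 1).choose 2 + 3 * (j + 1).choose 3 + 2 * (j + 1).choose 4 : ℕ) : ℚ)) -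
        (∑ j ∈ Finset.range 6, (Nat.choose (min 5 ((8 + 3) / 2 + 1 - 2)) j : ℚ) / (((j + 1) + 3 * (j + 1).choose 2 + 3 * (j + 1).choose 3 + 2 * (j + 1).choose 4 : ℕ) : ℚ))) *
        ((10 : ℕ).choose 5 : ℚ)) +
      (((13 + 8).choose 3 * 2 ^ 3 + (13 + 8).choose 2 * 2 + (13 + 8) + 1 : ℕ) : ℚ) +
      (((13 + 8).choose 5 : ℚ) + (∑ j ∈ Finset.range (8), (Nat.choose (min 13 ((8 + 6) / 2 + 1 - 2)) j : ℚ) / (((j + 1) + 3 * (j + 1).choose 2 + 3 * (j + 1).choose 3 + 2 * (j + 1).choose 4 : ℕ) : ℚ)) * ((13 * (13 + 8 - 3).choose 3 + 85 * (13 + 8 - 4).choose 2 + 526 * (13 + 8 - 5) + (8 + 5).choose 6 : ℕ) : ℚ) +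
        ((∑ j ∈ Finset.range (8), (Nat.choose (min 19 (5 + 8) - 6) j : ℚ) / (((j + 1) + 3 * (j + 1).choose 2 + 3 * (j + 1).choose 3 + 2 * (j + 1).choose 4 : ℕ) : ℚ)) - (∑ j ∈ Finset.range (8), (Nat.choose (min 13 ((8 + 6) / 2 + 1 - 2)) j : ℚ) / (((j + 1) + 3 * (j + 1).choose 2 + 3 * (j + 1).choose 3 + 2 * (j + 1).choose 4 : ℕ) : ℚ))) *
        ((min 19 (5 + 8)).choose 6 : ℚ)) +
      (S : ℚ)) ≤ (m : ℚ) * 2 ^ (13 + 8) := by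
  have hsm : (∑ j ∈ Finset.range (8), (Nat.choose (min 13 ((8 + 6) / 2 + 1 - 2)) j : ℚ) / (((j + 1) + 3 * (j + 1).choose 2 + 3 * (j + 1).choose 3 + 2 * (j + 1).choose 4 : ℕ) : ℚ)) = 414767 / 103635 := by
    norm_num [Finset.sum_range_succ, Nat.choose]
  have hsg : (∑ j ∈ Finset.range (8), (Nat.choose (min 19 (5 + 8) - 6) j : ℚ) / (((j + 1) + 3 * (j + 1).choose 2 + 3 * (j + 1).choose 3 + 2 * (j + 1).choose 4 : ℕ) : ℚ)) = 6418141 / 1184400 := by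
    norm_num [Finset.sum_range_succ, Nat.choose]
  have hs4m : (∑ j ∈ Finset.range 6, (Nat.choose (min 5 ((8 + 3) / 2 + 1 - 2)) j : ℚ) / (((j + 1) + 3 * (j + 1).choose 2 + 3 * (j + 1).choose 3 + 2 * (j + 1).choose 4 : ℕ) : ℚ)) = 523 / 225 := by
    norm_num [Finset.sum_range_succ, Nat.choose]
  have hs4g : (∑ j ∈ Finset.range 6, (Nat.choose 5 j : ℚ) / (((j + 1) + 3 * (j + 1).choose 2 + 3 * (j + 1).choose 3 + 2 * (j + 1).choose 4 : ℕ) : ℚ)) = 12767 / 4230 := by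
    norm_num [Finset.sum_range_succ, Nat.choose]
  rw [hsm, hsg, hs4m, hs4g]
  norm_num [Nat.choose] at h ⊢
  linarith

/-- **The case `ν = 7` of the coloop-free cell `(13, 8)`**: a set of nullity `7` on `≤ 12` points, by the kit's hitting counts
(`#U ≤ 30030`, `#spanning ≤ 33515`, `m = 104`). -/
theorem c025_thirteen_eight_cf_nu_seven (M : Matroid α) [M.Finite]
    (hR : M.eRank = ((13 : ℕ) : ℕ∞)) (hn : M.E.ncard = 13 + 8)
    (hfree : ∀ e ∈ M.E, ∃ A ⊆ M.E \ {e}, e ∉ M.closure A ∧ e ∉ M.closure ((M.E \ {e}) \ A)) (hK : ∀ e, ¬ M.IsColoop e)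
    (h7 : ∃ W ⊆ M.E, W.ncard ≤ 12 ∧ W.encard = M.eRk W + 7) : RLS M 13 5 := by
  classical
  have hd : M.E.encard = M.eRank + ((8 : ℕ) : ℕ∞) := by
    rw [hR, ← M.ground_finite.cast_ncard_eq, hn]
    push_cast
    ring
  obtain ⟨hs3, hs4, hs5⟩ := caps_thirteen_eight_cf M hd hn hfree hK
  obtain ⟨W, hW, hWn, hWk⟩ := h7
  have full : Matroid.topCount M 13 5 ≤ ∑ m ∈ Finset.Icc 5 8, ∑ j ∈ Finset.Icc (m + 7 - 8) m,
      W.ncard.choose j * (13 + 8 - W.ncard).choose (m - j) := by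
    refine (S2.topCount_le_sum_spanning M hR hd 5).trans ?_
    refine Finset.sum_le_sum (fun m _ => ?_)
    have h := S2.ncard_spanning_compl_le_of_nullity M hW hd hWk (m := m)
    rw [hn] at h
    exact h
  have hU' : Matroid.topCount M 13 5 ≤ 30030 := by
    refine full.trans ?_
    generalize W.ncard = w at hWn ⊢
    interval_cases w <;> decide
  have hS' : {X : Set α | X ⊆ M.E ∧ M.eRk X = M.eRank}.ncard ≤ 33515 := by
    refine (S2.ncard_spanning_le_of_nullity M hW hd hWk).trans ?_
    rw [hn]
    generalize W.ncard = w at hWn ⊢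
    interval_cases w <;> decide
  rw [RLS_iff]
  exact c025_core_five_cell_of_topCount_spanning_xqictq5g M 13 8 (by norm_num) hR hn hfree 13 85 526 hs3 hs4 hs5 30030 hU'
    33515 hS' 9480 (by norm_num) (phiK 13 5) (by rw [phiK_thirteen_five]; norm_num)
    ⟨104, by norm_num, by norm_num, tail_thirteen_eight_cf 33515 104 (by norm_num)⟩

/-- **The coloop-free cell `(13, 8)` modulo its case `ν = 4` and its spread case** (the cases `ν = 7, 6, 5` are theorems). -/
theorem c025_thirteen_eight_cf_of_nu_four_of_spread
    (hnu4 : ∀ (M : Matroid α) [M.Finite], M.eRank = ((13 : ℕ) : ℕ∞) → M.E.ncard = 13 + 8 →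
      (∀ e ∈ M.E, ∃ A ⊆ M.E \ {e}, e ∉ M.closure A ∧ e ∉ M.closure ((M.E \ {e}) \ A)) → (∀ e, ¬ M.IsColoop e) →
      ¬ (∃ W ⊆ M.E, W.ncard ≤ 12 ∧ W.encard = M.eRk W + 7) → ¬ (∃ W ⊆ M.E, W.ncard ≤ 11 ∧ W.encard = M.eRk W + 6) →
      ¬ (∃ W ⊆ M.E, W.ncard ≤ 10 ∧ W.encard = M.eRk W + 5) → (∃ W ⊆ M.E, W.ncard ≤ 9 ∧ W.encard = M.eRk W + 4) → RLS M 13 5)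
    (hspread : ∀ (M : Matroid α) [M.Finite], M.eRank = ((13 : ℕ) : ℕ∞) → M.E.ncard = 13 + 8 →
      (∀ e ∈ M.E, ∃ A ⊆ M.E \ {e}, e ∉ M.closure A ∧ e ∉ M.closure ((M.E \ {e}) \ A)) → (∀ e, ¬ M.IsColoop e) →
      ¬ (∃ W ⊆ M.E, W.ncard ≤ 9 ∧ W.encard = M.eRk W + 4) → RLS M 13 5)
    (M : Matroid α) [M.Finite]
    (hR : M.eRank = ((13 : ℕ) : ℕ∞)) (hn : M.E.ncard = 13 + 8)
    (hfree : ∀ e ∈ M.E, ∃ A ⊆ M.E \ {e}, e ∉ M.closure A ∧ e ∉ M.closure ((M.E \ {e}) \ A)) (hK : ∀ e, ¬ M.IsColoop e) :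
    RLS M 13 5 := by
  classical
  by_cases h7 : ∃ W ⊆ M.E, W.ncard ≤ 12 ∧ W.encard = M.eRk W + 7
  · exact c025_thirteen_eight_cf_nu_seven M hR hn hfree hK h7
  by_cases h6 : ∃ W ⊆ M.E, W.ncard ≤ 11 ∧ W.encard = M.eRk W + 6
  · exact c025_thirteen_eight_cf_nu_six M hR hn hfree hK h7 h6
  by_cases h5 : ∃ W ⊆ M.E, W.ncard ≤ 10 ∧ W.encard = M.eRk W + 5
  · exact c025_thirteen_eight_cf_nu_five M hR hn hfree hK h6 h5
  by_cases h4 : ∃ W ⊆ M.E, W.ncard ≤ 9 ∧ W.encard = M.eRk W + 4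
  · exact hnu4 M hR hn hfree hK h7 h6 h5 h4
  · exact hspread M hR hn hfree hK h4

end ThmN

end PercRepro
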